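import Literature.AlgebraicGeometry.Motives.JacobianThetaDivisorUniq
import HarnessLib

/-!
# `p^*` is the `ē`-adjoint of `Nm_p` as soon as `D_{p^*Q}(Θ_X) ∼ Nm_p^* D_Q(Θ_Y)` (Lange (4.9) in divisor currency)

Layer `Literature/AlgebraicGeometry/Motives`, namespaces `….Motives.AbelianVariety` (§1–§2) and `….Motives.Jacobian` (§3).  KERNEL
ONLY (theorems; no definition, no named fact, no instance, no `sorry`).  Sequel of ★ `Motives/AbelianVarietyWeilPairingPullback`
(`ē_N^{f^*Θ}(P, Q) = ē_N^Θ(fP, fQ)`), ★ `Motives/JacobianGaloisCoverNormAdjointIff` ((F-P2) ⟺ (C) ∧ (D)) and ★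
`Motives/JacobianThetaDivisorUniq` ((F-P2) ⟺ (C)).

## The mathematics

Lange–Birkenhake, *Complex Abelian Varieties*, §5.3.2 Lemma 5.3.7: for a finite cover `f : C → C′` of degree `n` with norm map
`N_f : J → J′` and `f^* : J′ → J`, «`φ_{nΘ′} = n_{J′} = N_f f^* = \widehat{f^*} f^* = φ_{(f^*)^*Θ}`», using §4.5.2 eq. (4.9)
«`N̂_f φ_{Θ′} = φ_Θ f^*`».  The tree reads `φ_Θ(x)` as the divisor `D_x(Θ) = t_x^*Θ − Θ` (★ `AbelianVariety.weilDiv`) and `N̂_f` as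
pull-back of divisors along the (dominant) homomorphism `N_f`; so (4.9) reads

  **(4.9)_div**  `D_{f^*Q}(Θ) ∼ N_f^* D_Q(Θ′)` for the points `Q` of `J′`,

while `(f^*)^*Θ` itself is NOT expressible (`f^*` is not dominant for `g(C) > g(C′)`; ★ `CartierDivisor.pullback` is along dominant
maps only).  Lemma 5.3.7's computation nevertheless goes through ON TORSION POINTS: for `P, Q ∈ J′[N]`,

  `ē_N^{Θ}(f^*P, f^*Q) = e_N(f^*P, D_{f^*Q}(Θ)) = e_N(f^*P, N_f^* D_Q(Θ′)) = e_N(N_f f^* P, D_Q(Θ′)) = e_N(P^n, D_Q(Θ′)) = ē_N^{Θ′}(P, Q)^n`,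

the third step being the functoriality of the Kummer constant `e_N(σ, E) = t_σ^♯ h / h` under a dominant homomorphism (§1, the
kernel of ★ `weilPairingLevel_pullback_eq`), the fourth `N_f f^* = n`.  This is statement (C) «`(f^*)^*Θ ≡ nΘ′` on torsion points»
of ★ `galoisCover_pullback_isWeilPairingAdjoint_norm_iff(_pullbackPow)`; hence (§3) **the interface fact (F-P2)
`Jacobian.galoisCover_pullback_isWeilPairingAdjoint_norm` («`p^*` is the `ē`-adjoint of `Nm_p`») FOLLOWS from (4.9)_div** for
Galois covers of complex curves — the one divisor-class identity that Lange's Lemma 4.4.4 / Cor. 4.4.5 / Cor. 4.5.2 deliver.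

## What is proved
§1 `AbelianVariety.kummerConst_comp_hom` (`e_N(σ, f^*E)` computed with `f^♯h` equals `e_N(fσ, E)`); §2
**`AbelianVariety.weilPairingLevel_map_map_eq_pow_of_weilDiv_linEquiv_pullback`** (`u : B → A`, `v : A → B` dominant, `u ≫ v = n`,
`D_{uQ}(Θ_A) ∼ v^* D_Q(Θ_B)` for `Q ∈ B[N]` ⇒ `ē_N^{Θ_A}(uP, uQ) = ē_N^{Θ_B}(P, Q)^n`); §3 `Jacobian.isDominant_toSchemeHom_pushforward_of_pin`
(`Nm_p` is dominant), **`Jacobian.galoisCover_pullback_isWeilPairingAdjoint_norm_of_normPullback_weilDiv`** ((F-P2) ⟸ (4.9)_div).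
Use (cell `hodgecm-mathlib`, D-0151; crux HLiu418 = stmt-HodgeConjecture-24832, interface row VI-8, route G4 leaf (g4-4)): reduces the
row to the single divisor-class identity (4.9)_div, the deliverable of leaves (g4-1)–(g4-3).  COUNT-NEUTRAL; nothing here proves (4.9).
HC_CM is proved only modulo the 7 printed citations until rung 0 closes; this file moves no book by itself.

## References
* [Lange2023AbelianVarietiesComplex] H. Lange, *Abelian Varieties over the Complex Numbers* (2023), §4.5.2 eq. (4.9), §5.3.2
  Lemma 5.3.7; = [BirkenhakeLange2004] C. Birkenhake, H. Lange, *Complex Abelian Varieties* (2004), §11.4 eq. (2), §12.3 Lemma 12.3.1.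
* [MumfordAV1970] D. Mumford, *Abelian Varieties* (1970), §20, property (3) of `e_n` («`e_n(f(x), y) = e_n(x, f̂(y))`», p. 186).
* [Lang1983AbelianVarieties] S. Lang, *Abelian Varieties* (1983), Ch. VII §2 Props. 2–3 (the Kummer / Weil pairing `e_n(a, X)`).
* [LangeRodriguez2022] H. Lange, R. E. Rodríguez, *Decomposition of Jacobians by Prym Varieties* (2022), §3.2.1 eq. (3.3),
  Prop. 3.2.1 (a), §3.5.1 Prop. 3.5.1 (`Nm_f ∘ f^* = d`, `f^*` pinned by `f^* ∘ Nm_f = Σ δ`).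
-/

set_option autoImplicit false

noncomputable section

open CategoryTheory AlgebraicGeometry

universe u

namespace Literature.AlgebraicGeometry.Motives

namespace AbelianVariety

open RatFn
open scoped MonObj

variable {K : Type u} [Field K] {A B : AbelianVariety K}

/-! ## §1 The Kummer constant under a dominant homomorphism -/

/-- **`e_N(σ, f^*E) = e_N(fσ, E)`**: for a dominant homomorphism `f : A → B`, a divisor `E` on `B` with `[N]^*E` trivialised by `h`,
and `σ ∈ A[N]`, the Kummer constant of `f^*E` at `σ` computed with the transported trivialiser `f^♯h` (★ `IsTrivializer.comp_hom`)
is the Kummer constant of `E` at `fσ`: `t_σ^♯ f^♯ h / f^♯ h = f^♯ (t_{fσ}^♯ h / h) = f^♯ e_N(fσ, E) = e_N(fσ, E)` (homomorphisms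
intertwine translations and fix constants).  Mumford §20 (3): «`e_n(f(x), y) = e_n(x, f̂(y))`»; Lang VII §2 Prop. 3.
[cite: MumfordAV1970, §20 (property (3) of e_n, p. 186)] [cite: Lang1983AbelianVarieties, Ch. VII §2 Prop. 3] -/
theorem kummerConst_comp_hom (f : A ⟶ B) [IsDominant (Hom.toSchemeHom f)]
    {N : ℕ} [IsDominant (Hom.toSchemeHom ((N : ℤ) • 𝟙 A))] [IsDominant (Hom.toSchemeHom ((N : ℤ) • 𝟙 B))]
    {E : CartierDivisor B.X.left} {h : B.X.left.functionField} (hh : B.IsTrivializer (n := N) E h)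
    (σ : A.torsionPoints K N) :
    kummerConst (hh.comp_hom f) σ = kummerConst hh ⟨AlgPoints.map f.hom.hom.hom σ.1, map_mem_torsionPoints f σ.2⟩ := by
  apply (algebraMap K A.X.left.functionField).injective
  rw [algebraMap_kummerConst]
  -- `t_σ^♯ ∘ f^♯ = f^♯ ∘ t_{fσ}^♯`
  have ht := translation_left_comp_toSchemeHom f σ.1
  haveI : IsDominant ((A.translation σ.1).left ≫ Hom.toSchemeHom f) := inferInstance
  haveI : IsDominant (Hom.toSchemeHom f ≫ (B.translation (AlgPoints.map f.hom.hom.hom σ.1)).left) := inferInstance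
  have hFF : (functionFieldMap (A.translation σ.1).left).comp (functionFieldMap (Hom.toSchemeHom f)) =
      (functionFieldMap (Hom.toSchemeHom f)).comp
        (functionFieldMap (B.translation (AlgPoints.map f.hom.hom.hom σ.1)).left) := by
    have h1 := functionFieldMap_congr ht
    rw [functionFieldMap_comp, functionFieldMap_comp] at h1
    exact h1
  change functionFieldMap (A.translation σ.1).left (functionFieldMap (Hom.toSchemeHom f) h) /
      functionFieldMap (Hom.toSchemeHom f) h = _
  rw [← RingHom.comp_apply (functionFieldMap (A.translation σ.1).left), hFF, RingHom.comp_apply, ← map_div₀]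
  change functionFieldMap (Hom.toSchemeHom f) (B.translFF (AlgPoints.map f.hom.hom.hom σ.1) h / h) = _
  rw [← algebraMap_kummerConst hh ⟨AlgPoints.map f.hom.hom.hom σ.1, map_mem_torsionPoints f σ.2⟩,
    functionFieldMap_toSchemeHom_algebraMap]

/-! ## §2 Lemma 5.3.7 on torsion points: `ē^{Θ_A}(uP, uQ) = ē^{Θ_B}(P, Q)^n` from (4.9)_div -/

/-- `v(uP) = P^n` on points when `u ≫ v = n • 𝟙`. [cite: LangeRodriguez2022, §3.2.1 (pp. 46–47, Nm_f ∘ f^* = d_J)] -/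
theorem map_map_eq_pow_of_comp_eq_zsmul (u : B ⟶ A) (v : A ⟶ B) {n : ℕ} (huv : u ≫ v = (n : ℤ) • 𝟙 B) (P : B.Points K) :
    AlgPoints.map v.hom.hom.hom (AlgPoints.map u.hom.hom.hom P) = P ^ n := by
  rw [← map_hom_comp_apply, huv, AlgPoints.map_apply, hom_natCast_zsmul_id, MonObj.comp_pow, Category.comp_id]

/-- **Lemma 5.3.7 on torsion points.**  Let `u : B → A` and `v : A → B` be homomorphisms of abelian varieties with `v` dominant and
`u ≫ v = n • 𝟙_B` (for a cover of curves: `u = f^*`, `v = N_f`, `n = deg f`), `Θ_A`, `Θ_B` Cartier divisors, and suppose the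
divisor-class identity (4.9)_div «`D_{uQ}(Θ_A) ∼ v^* D_Q(Θ_B)`» for the `N`-torsion points `Q` of `B` (Lange (4.9)
«`N̂_f φ_{Θ′} = φ_Θ f^*`»).  THEN `ē_N^{Θ_A}(uP, uQ) = ē_N^{Θ_B}(P, Q)^n` for all `P, Q ∈ B[N]` — Lange's
«`\widehat{f^*} φ_Θ f^* = N_f f^* = n = φ_{nΘ′}`» read through `ē`: `ē^{Θ_A}(uP, uQ) = e_N(uP, v^*D_Q(Θ_B))` (★
`weilPairingLevel_eq_kummerConst_of_linEquiv`) `= e_N(v u P, D_Q(Θ_B))` (§1) `= e_N(P^n, D_Q) = ē^{Θ_B}(P, Q)^n` (★ `weilPairingLevel_pow_left`).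
[cite: Lange2023AbelianVarietiesComplex, §4.5.2 eq. (4.9) and §5.3.2 Lemma 5.3.7 (p. 277)] [cite: MumfordAV1970, §20 (property (3) of e_n, p. 186)] -/
theorem weilPairingLevel_map_map_eq_pow_of_weilDiv_linEquiv_pullback (u : B ⟶ A) (v : A ⟶ B) [IsDominant (Hom.toSchemeHom v)]
    {n : ℕ} (huv : u ≫ v = (n : ℤ) • 𝟙 B) (ΘA : CartierDivisor A.X.left) (ΘB : CartierDivisor B.X.left)
    {N : ℕ} [IsDominant (Hom.toSchemeHom ((N : ℤ) • 𝟙 A))] [IsDominant (Hom.toSchemeHom ((N : ℤ) • 𝟙 B))]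
    (h49 : ∀ Q : B.torsionPoints K N,
      (A.weilDiv ΘA (AlgPoints.map u.hom.hom.hom Q.1)).LinEquiv ((B.weilDiv ΘB Q.1).pullback (Hom.toSchemeHom v)))
    (P Q : B.torsionPoints K N) :
    A.weilPairingLevel ΘA ⟨AlgPoints.map u.hom.hom.hom P.1, map_mem_torsionPoints u P.2⟩
        ⟨AlgPoints.map u.hom.hom.hom Q.1, map_mem_torsionPoints u Q.2⟩ =
      B.weilPairingLevel ΘB P Q ^ n := by
  -- the trivialiser `g = g_Q` of `[N]^* D_Q(Θ_B)` and its transport `v^♯ g`, a trivialiser of `[N]^* v^* D_Q(Θ_B)`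
  have hg : B.IsTrivializer (n := N) (B.weilDiv ΘB Q.1) (B.weilFn ΘB Q) := B.isTrivializer_weilFn ΘB Q
  -- `ē^{Θ_A}(uP, uQ) = e_N(uP, v^* D_Q(Θ_B))` computed with `v^♯ g`
  rw [weilPairingLevel_eq_kummerConst_of_linEquiv (Q := ⟨AlgPoints.map u.hom.hom.hom Q.1, map_mem_torsionPoints u Q.2⟩)
      (hg.comp_hom v) (h49 Q) ⟨AlgPoints.map u.hom.hom.hom P.1, map_mem_torsionPoints u P.2⟩]
  -- `= e_N(v u P, D_Q(Θ_B))`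
  rw [kummerConst_comp_hom v hg ⟨AlgPoints.map u.hom.hom.hom P.1, map_mem_torsionPoints u P.2⟩]
  -- `v u P = P ^ n`
  have hPn : (⟨AlgPoints.map v.hom.hom.hom (AlgPoints.map u.hom.hom.hom P.1),
      map_mem_torsionPoints v (map_mem_torsionPoints u P.2)⟩ : B.torsionPoints K N) = P ^ n :=
    Subtype.ext ((map_map_eq_pow_of_comp_eq_zsmul u v huv P.1).trans (SubgroupClass.coe_pow P n).symm)
  rw [hPn, kummerConst_pow, weilPairingLevel_eq_kummerConst (Q := Q) hg P]

end AbelianVariety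

namespace Jacobian

open scoped MonObj

variable {k : Type u} [Field k] {X Y : SchemeOver k}

/-! ## §3 (F-P2) ⟸ (4.9)_div for Galois covers of complex curves -/

/-- **`Nm_p` is dominant** for a Galois cover `p : X → Y = X/Δ` with a rational point on `X`: `t ≫ Nm_p = |Δ| • 𝟙_{J_Y}` (★
`comp_pushforward_eq_card_zsmul`) with `[|Δ|]` dominant (`hN`), and a morphism whose precomposite is dominant is dominant.
[cite: LangeRodriguez2022, §3.2.1 (pp. 46–47, Nm_f ∘ f^* = d_J) and §3.5.1 Prop. 3.5.1 (p. 65)] -/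
theorem isDominant_toSchemeHom_pushforward_of_pin (𝒥X : Jacobian X) (𝒥Y : Jacobian Y) {Δ : Type} [Fintype Δ]
    (act : Δ → (X ≅ X)) (p : X ⟶ Y) (hp : IsSepQuotient act p) (P₀ : AlgPoints X k) (t : 𝒥Y.J ⟶ 𝒥X.J)
    (ht : 𝒥X.pushforward 𝒥Y p ≫ t = ∑ δ : Δ, 𝒥X.pushforward 𝒥X (act δ).hom)
    (hN : IsDominant (AbelianVariety.Hom.toSchemeHom ((Fintype.card Δ : ℤ) • 𝟙 𝒥Y.J))) :
    IsDominant (AbelianVariety.Hom.toSchemeHom (𝒥X.pushforward 𝒥Y p)) := by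
  have htNm := 𝒥X.comp_pushforward_eq_card_zsmul 𝒥Y act p hp P₀ t ht
  have hcomp : AbelianVariety.Hom.toSchemeHom t ≫ AbelianVariety.Hom.toSchemeHom (𝒥X.pushforward 𝒥Y p) =
      AbelianVariety.Hom.toSchemeHom ((Fintype.card Δ : ℤ) • 𝟙 𝒥Y.J) := by
    rw [← htNm]; rfl
  have hd : DenseRange (AbelianVariety.Hom.toSchemeHom t ≫ AbelianVariety.Hom.toSchemeHom (𝒥X.pushforward 𝒥Y p)).base := by
    rw [hcomp]; exact hN.denseRange
  exact ⟨DenseRange.of_comp (by simpa only [Scheme.Hom.comp_base, TopCat.coe_comp] using hd)⟩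

/-- **(F-P2) ⟸ (4.9)_div.**  IF for every Galois cover `p : X → Y = X/Δ` of smooth projective complex curves (binders of the interface
fact verbatim: Jacobians, `dim J_Y ≥ 1`, faithful `Δ`, `IsSepQuotient`, principal Riemann theta divisors `Θ_X`, `Θ_Y`, `t` pinned by
`Nm_p ≫ t = Σ δ_*`, a level `N` with `[N]` dominant) the divisor-class identity «`D_{tQ}(Θ_X) ∼ Nm_p^* D_Q(Θ_Y)`» holds for the
`N`-torsion points `Q` of `J_Y` — Lange's (4.9) «`N̂_f φ_{Θ′} = φ_Θ f^*`», the content of Lemma 4.4.4 / Cor. 4.4.5 / Cor. 4.5.2 — THEN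
`p^*` is the `ē`-adjoint of `Nm_p`: `ē_N^{Θ_X}(tP, Q) = ē_N^{Θ_Y}(P, Nm_p Q)`.  Assembly: ★ `galoisCover_pullback_isWeilPairingAdjoint_norm_iff_pullbackPow`
((F-P2) ⟺ (C)) and §2 with `n = |Δ|` (★ `comp_pushforward_eq_card_zsmul`).
[cite: Lange2023AbelianVarietiesComplex, §4.5.2 eq. (4.9) and §5.3.2 Lemma 5.3.7 (p. 277)]
[cite: LangeRodriguez2022, §3.2.1 eq. (3.3) and Prop. 3.2.1 (a) (pp. 46–47); §3.5.1 Prop. 3.5.1 (p. 65)]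
[cite: BirkenhakeLange2004, §12.3 Lemma 12.3.1 (p. 372) and §11.4 eq. (2) (p. 331)] -/
theorem galoisCover_pullback_isWeilPairingAdjoint_norm_of_normPullback_weilDiv
    (h49 : ∀ (X Y : SchemeOver ℂ), IsSmoothProjective 1 X → IsSmoothProjective 1 Y →
      ∀ (𝒥X : Jacobian X) (𝒥Y : Jacobian Y), 1 ≤ 𝒥Y.J.dim →
      ∀ (Δ : Type) [Group Δ] [Fintype Δ] (act : Δ →* Aut X), Function.Injective act →
      ∀ (p : X ⟶ Y), IsSepQuotient (fun δ : Δ => act δ) p →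
      ∀ (ΘX : CartierDivisor 𝒥X.J.X.left) (ΘY : CartierDivisor 𝒥Y.J.X.left),
        𝒥X.IsRiemannThetaDivisor ΘX → 𝒥X.J.IsPrincipalPolarizationDivisor ΘX →
        𝒥Y.IsRiemannThetaDivisor ΘY → 𝒥Y.J.IsPrincipalPolarizationDivisor ΘY →
      ∀ (t : 𝒥Y.J ⟶ 𝒥X.J), 𝒥X.pushforward 𝒥Y p ≫ t = ∑ δ : Δ, 𝒥X.pushforward 𝒥X (act δ).hom →
      ∀ [IsDominant (AbelianVariety.Hom.toSchemeHom (𝒥X.pushforward 𝒥Y p))]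
        (N : ℕ) [IsDominant (AbelianVariety.Hom.toSchemeHom ((N : ℤ) • 𝟙 𝒥Y.J))]
        (Q : 𝒥Y.J.torsionPoints ℂ N),
        (𝒥X.J.weilDiv ΘX (AlgPoints.map t.hom.hom.hom Q.1)).LinEquiv
          ((𝒥Y.J.weilDiv ΘY Q.1).pullback (AbelianVariety.Hom.toSchemeHom (𝒥X.pushforward 𝒥Y p)))) :
    galoisCover_pullback_isWeilPairingAdjoint_norm := by
  refine galoisCover_pullback_isWeilPairingAdjoint_norm_iff_pullbackPow.mpr
    fun X Y hX hY 𝒥X 𝒥Y hdim Δ _ _ act hact p hp ΘX ΘY h1 h2 h3 h4 t ht N _ _ P Q => ?_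
  obtain ⟨P₀⟩ := hX.nonempty_algPoints ℂ
  have htNm := 𝒥X.comp_pushforward_eq_card_zsmul 𝒥Y (fun δ : Δ => act δ) p hp P₀ t ht
  -- `[|Δ|]` is an isogeny of the complex abelian variety `J_Y`, hence dominant; so `Nm_p` is dominant
  have hdom : IsDominant (AbelianVariety.Hom.toSchemeHom ((Fintype.card Δ : ℤ) • 𝟙 𝒥Y.J)) :=
    ⟨(𝒥Y.J.isIsogeny_zsmul_id_of_cast_ne_zero (Fintype.card Δ : ℤ)
      (by exact_mod_cast (Fintype.card_ne_zero : Fintype.card Δ ≠ 0))).1.1.denseRange⟩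
  haveI : IsDominant (AbelianVariety.Hom.toSchemeHom (𝒥X.pushforward 𝒥Y p)) :=
    isDominant_toSchemeHom_pushforward_of_pin 𝒥X 𝒥Y (fun δ : Δ => act δ) p hp P₀ t ht hdom
  exact AbelianVariety.weilPairingLevel_map_map_eq_pow_of_weilDiv_linEquiv_pullback t (𝒥X.pushforward 𝒥Y p) htNm ΘX ΘY
    (fun Q' => h49 X Y hX hY 𝒥X 𝒥Y hdim Δ act hact p hp ΘX ΘY h1 h2 h3 h4 t ht N Q') P Q

end Jacobian

end Literature.AlgebraicGeometry.Motives

end
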